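import Summits.CriticalPhenomena.PercolationContinuityZ3.Theorems.Transplant.ProdSkeletonNeg
import Summits.CriticalPhenomena.PercolationContinuityZ3.Theorems.Transplant.CayleySkeletonFrm
import HarnessLib

/-!
# `θ(p_c) = 0` on `X □ Cay(Γ;S)` for EVERY vertex-transitive `X` and every `CayleyFrm₂` datum on `(Γ, S)` — NO automorphism of `(Γ, S)`, modulo the
# single-type frames-only node N2

builds on p205010 (kernel theorem, internal audit signed; external expert review pending) — nothing in this file uses p205010; the frames-only node
`SamePDropOfSkeletonFrm₁` is an OPEN `Prop` of this programme, taken as a HYPOTHESIS (`hN`); nothing is claimed about it.  Lane `prim-bschramm`,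
seat `prim-bschramm-p4` gen 13 (PART C3 of `P4-GENERAL.md` §35).  Helper file (`--supports stmt-CriticalPhenomena-4575 --as helper`).

Gen 12's `CayleyNeg₂.theta_boxProd_eq_zero_of_le` (file `ProdSkeletonNeg`) needs ONE reversing automorphism `ν` on the Cayley factor (closed `{±1}`
node).  Dropping it: `X □ Cay(Γ;S)` carries the one-type `PlanarSkeletonFrm` `(u, g) ↦ φ g` (`prodSkeletonFrm`: frames `γ × L_g`, cylinders
`X × C_ℓ`, no point symmetry) for every connected, locally finite, VERTEX-TRANSITIVE `X` with a degree bound and every `CayleyFrm₂` (additive unit-range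
chart with unit steps, `C_1` connected); its cylinders are subcritical at `p_c` by gen 11's product strict inequality
(`CylData₂.theta_prodCyl_criticalProb_eq_zero`, unconditional); hence **`CayleyFrm₂.theta_boxProd_eq_zero_of_le_of_frmNode₁`: modulo N2, `θ_v(p) = 0`
for every `p ≤ p_c` at every vertex of `X □ Cay(Γ;S)`** — e.g. `X □ Cay(H₃(ℤ); GRR set)`, `Cay(Γ';S') □ Cay(Γ; A)` for every f.g. `Γ'` and every
class-≤3 letters datum without symmetry (`NilThreeFrm.Data`).
[cite: BenjaminiSchramm1996, Conj. 4; §2 (products, quasi-transitive graphs)] [cite: KozmaNitzan2024, §1 p. 2 (approach 1)]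
[cite: AizenmanGrimmett1991, Thm 1 (essential enhancements)]
-/

noncomputable section

namespace Summit.CriticalPhenomena.PercolationContinuityZ3.Theorems.Transplant

open SimpleGraph Walk Literature.Probability.LatticeModels Literature.Probability.Percolation
open Literature.Barriers.CriticalPhenomena (countable_of_connected_of_locallyFinite)
open scoped Classical

namespace CayleyFrm₂

variable {Γ : Type} [Group Γ] {S : Finset Γ} (C : CayleyFrm₂ Γ S)
variable {W : Type} (X : SimpleGraph W) [X.LocallyFinite]

/-! ## §1 The one-type frames-only product skeleton -/

/-- **THE ONE-TYPE FRAMES-ONLY SKELETON OF `X □ Cay(Γ;S)`** for vertex-transitive `X`: height through the Cayley factor, base vertex `(x₀, 1)`,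
frames `γ × L_g`, no point symmetry. [cite: KozmaNitzan2024, §4 p. 16 (Lemma 8)] [cite: BenjaminiSchramm1996, §2 (products)] -/
def prodSkeletonFrm (hc : X.Connected) {ΔX : ℕ} (hΔ : ∀ u, X.degree u ≤ ΔX) (x₀ : W) (hT : ∀ u : W, ∃ γ : X ≃g X, γ x₀ = u) :
    PlanarSkeletonFrm (X □ mulCayley (S : Set Γ)) where
  φ := fun w => C.φ w.2
  lip := fun a b h i => by
    rcases boxProd_adj.1 h with ⟨-, h2⟩ | ⟨h1, -⟩
    · rw [h2, sub_self, abs_zero]; exact zero_le_one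
    · rw [abs_sub_comm]; exact C.base.lip_adj h1 i
  types := {(x₀, 1)}
  frame := fun v => by
    obtain ⟨γ, hγ⟩ := hT v.1
    refine ⟨(x₀, 1), Finset.mem_singleton_self _, boxProdIso γ (leftMulIso S v.2), ?_, fun w => ?_⟩
    · rw [boxProdIso_apply, leftMulIso_apply, mul_one, hγ]
    · rw [boxProdIso_apply, leftMulIso_apply]
      show C.φ (v.2 * w.2) = C.φ w.2 + (C.φ v.2 - C.φ 1)
      rw [C.map_mul, C.φ_one, sub_zero, add_comm]
  Δ := ΔX + 2 * S.card
  degree_le := fun v => by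
    rw [degree_boxProd]
    exact add_le_add (hΔ v.1) (degree_mulCayley_le S v.2)
  step := fun v i σ => by
    obtain ⟨s, hs, hφ⟩ := C.step i
    have hs1 : s ≠ 1 := by
      intro h
      have h0 := congrFun hφ i
      rw [h, C.φ_one] at h0
      simp at h0
    rcases Int.units_eq_one_or σ with rfl | rfl
    · refine ⟨(v.1, v.2 * s), boxProd_adj_right.2 (CayCyl.adj_mul_of_mem S (Or.inl hs) hs1 v.2), ?_⟩
      show C.φ (v.2 * s) = C.φ v.2 + Pi.single i ((1 : ℤˣ) : ℤ)
      rw [C.map_mul, hφ, Units.val_one]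
    · refine ⟨(v.1, v.2 * s⁻¹), boxProd_adj_right.2 (CayCyl.adj_mul_of_mem S (Or.inr (by rw [inv_inv]; exact hs)) (inv_ne_one.2 hs1) v.2), ?_⟩
      show C.φ (v.2 * s⁻¹) = C.φ v.2 + Pi.single i ((-1 : ℤˣ) : ℤ)
      rw [C.map_mul, show C.φ s⁻¹ = -C.φ s from C.base.φ_inv s, hφ, Units.val_neg, Units.val_one, Pi.single_neg]
  cyl_connected := fun t ht ℓ hℓ => by
    rw [Finset.mem_singleton] at ht
    subst ht
    have e : {w : W × Γ | C.φ w.2 - C.φ (1 : Γ) ∈ box 2 ℓ} = (Set.univ : Set W) ×ˢ C.cylData₂.enl.V ℓ := by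
      ext w
      simp only [Set.mem_setOf_eq, Set.mem_prod, Set.mem_univ, true_and, CayCyl.CylData.V, C.φ_one, sub_zero]
      rfl
    show ((X □ mulCayley (S : Set Γ)).induce {w : W × Γ | C.φ w.2 - C.φ (1 : Γ) ∈ box 2 ℓ}).Connected
    rw [e]
    exact induce_univ_prod_connected X _ hc (C.cylData₂.cylG_connected_of_boxWalks C.exists_walk_inBox_one hℓ)

/-- The product skeleton has the single base type `(x₀, 1)`. [folklore] -/
@[simp] theorem prodSkeletonFrm_types (hc : X.Connected) {ΔX : ℕ} (hΔ : ∀ u, X.degree u ≤ ΔX) (x₀ : W)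
    (hT : ∀ u : W, ∃ γ : X ≃g X, γ x₀ = u) : (C.prodSkeletonFrm X hc hΔ x₀ hT).types = {(x₀, 1)} := rfl

/-! ## §2 The cylinders of the product are subcritical at `p_c` -/

/-- The cylinder of the frames-only product skeleton at `(x₀, 1)` is `X × C_ℓ`, as graphs. [folklore] -/
def cylIsoFrm (ℓ : ℕ) : (X □ mulCayley (S : Set Γ)).induce {w : W × Γ | C.φ w.2 - C.φ (1 : Γ) ∈ box 2 ℓ} ≃g C.cylData₂.pcylG X ℓ where
  toFun := fun w => (w.1.1, ⟨w.1.2, by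
    have h := w.2
    simp only [Set.mem_setOf_eq, C.φ_one, sub_zero] at h
    exact h⟩)
  invFun := fun v => ⟨(v.1, v.2.1), by
    have h := v.2.2
    simp only [Set.mem_setOf_eq, C.φ_one, sub_zero]
    exact h⟩
  left_inv := fun _ => rfl
  right_inv := fun _ => rfl
  map_rel_iff' := by
    intro a b
    simp only [Equiv.coe_fn_mk, boxProd_adj, comap_adj, Function.Embedding.subtype_apply]
    constructor
    · rintro (⟨h1, h2⟩ | ⟨h1, h2⟩)
      · exact Or.inl ⟨h1, congrArg Subtype.val h2⟩
      · exact Or.inr ⟨h1, h2⟩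
    · rintro (⟨h1, h2⟩ | ⟨h1, h2⟩)
      · exact Or.inl ⟨h1, Subtype.ext h2⟩
      · exact Or.inr ⟨h1, h2⟩

variable [Countable W]

/-- **Φ2 AT `p_c` FOR THE ONE-TYPE FRAMES-ONLY PRODUCT SKELETON (UNCONDITIONAL)**: the cylinders `X × C_ℓ` are subcritical at
`p_c(X □ Cay(Γ;S), (x₀,1))` (gen 11's product strict inequality `p_c(X □ C_{ℓ+2r+1}) < p_c(X □ C_ℓ)`). [cite: AizenmanGrimmett1991, Thm 1 (essential enhancements)]
[cite: BenjaminiSchramm1996, §2 (products)] -/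
theorem prod_cylSubcriticalFrm (hc : X.Connected) {ΔX : ℕ} (hΔ : ∀ u, X.degree u ≤ ΔX) (x₀ : W)
    (hT : ∀ u : W, ∃ γ : X ≃g X, γ x₀ = u) :
    (C.prodSkeletonFrm X hc hΔ x₀ hT).CylSubcritical (criticalProbIOf (X □ mulCayley (S : Set Γ)) (x₀, (1 : Γ))) := by
  haveI : Countable Γ := countable_of_connected_of_locallyFinite _ (C.skeletonFrm.graph_connected (1 : Γ)) 1
  rintro ⟨u₀, g₀⟩ ht' ℓ
  rw [prodSkeletonFrm_types, Finset.mem_singleton] at ht'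
  cases ht'
  have hlt : criticalProb (X □ mulCayley (S : Set Γ)) (x₀, (1 : Γ)) < 1 :=
    (C.prodSkeletonFrm X hc hΔ x₀ hT).criticalProb_lt_one _
  have h0 := C.cylData₂.theta_prodCyl_criticalProb_eq_zero X hc hΔ x₀ hlt ℓ
  have hθ := theta_iso (C.cylIsoFrm X ℓ) ⟨(x₀, (1 : Γ)), show C.φ (1 : Γ) - C.φ 1 ∈ box 2 ℓ by rw [sub_self]; exact zero_mem_box 2 ℓ⟩
    (criticalProbIOf (X □ mulCayley (S : Set Γ)) (x₀, (1 : Γ)))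
  change theta ((X □ mulCayley (S : Set Γ)).induce {w : W × Γ | C.φ w.2 - C.φ (1 : Γ) ∈ box 2 ℓ}) ⟨(x₀, (1 : Γ)), _⟩
    (criticalProbIOf (X □ mulCayley (S : Set Γ)) (x₀, (1 : Γ))) = 0
  rw [← hθ]
  exact h0

/-! ## §3 The conditional theorem -/

include C in
/-- **CONDITIONAL THEOREM (modulo N2, NO automorphism): `θ_v(p) = 0` for every `p ≤ p_c` at every vertex of `X □ Cay(Γ;S)`**, for every
connected, locally finite, VERTEX-TRANSITIVE graph `X` with a degree bound (every Cayley graph of every finitely generated group included) and every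
`(Γ, S)` carrying a `CayleyFrm₂` (additive unit-range chart with unit steps + connected unit cylinder); via the single-type frames-only node
`SamePDropOfSkeletonFrm₁` (OPEN; hypothesis `hN`), Φ2 DERIVED by the product strict inequality.
[cite: BenjaminiSchramm1996, Conj. 4; §2] [cite: AizenmanGrimmett1991, Thm 1] [cite: KozmaNitzan2024, §1 p. 2 (approach 1)] -/
theorem theta_boxProd_eq_zero_of_le_of_frmNode₁ (hN : SamePDropOfSkeletonFrm₁) (hc : X.Connected) {ΔX : ℕ} (hΔ : ∀ u, X.degree u ≤ ΔX)
    (hT : ∀ u u' : W, ∃ γ : X ≃g X, γ u = u') (v : W × Γ) {p : unitInterval}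
    (hp : (p : ℝ) ≤ criticalProb (X □ mulCayley (S : Set Γ)) v) : theta (X □ mulCayley (S : Set Γ)) v p = 0 := by
  haveI : Countable Γ := countable_of_connected_of_locallyFinite _ (C.skeletonFrm.graph_connected (1 : Γ)) 1
  set Φ := C.prodSkeletonFrm X hc hΔ v.1 (hT v.1)
  -- the node at the base vertex `(v.1, 1)`
  have hbase : theta (X □ mulCayley (S : Set Γ)) (v.1, (1 : Γ)) (criticalProbIOf (X □ mulCayley (S : Set Γ)) (v.1, (1 : Γ))) = 0 :=
    continuity_of_frmNode₁ hN _ Φ (Finset.mem_singleton_self _) rfl (C.prod_cylSubcriticalFrm X hc hΔ v.1 (hT v.1))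
  -- transport to `v = (v.1, v.2)` by the frame `id × L_{v.2}`
  set α : (X □ mulCayley (S : Set Γ)) ≃g (X □ mulCayley (S : Set Γ)) := boxProdIso (RelIso.refl _) (leftMulIso S v.2)
  have hαv : α (v.1, 1) = v := by
    change (boxProdIso (RelIso.refl _) (leftMulIso S v.2)) (v.1, 1) = v
    rw [boxProdIso_apply, leftMulIso_apply, mul_one]; rfl
  have hθ := theta_iso α (v.1, (1 : Γ)) (criticalProbIOf (X □ mulCayley (S : Set Γ)) (v.1, (1 : Γ)))
  have hpc := criticalProb_iso α (v.1, (1 : Γ))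
  rw [hαv] at hθ hpc
  have e : criticalProbIOf (X □ mulCayley (S : Set Γ)) v = criticalProbIOf (X □ mulCayley (S : Set Γ)) (v.1, (1 : Γ)) := Subtype.ext hpc
  have hpc0 : theta (X □ mulCayley (S : Set Γ)) v (criticalProbIOf (X □ mulCayley (S : Set Γ)) v) = 0 := by rw [e, hθ]; exact hbase
  have hmono : theta (X □ mulCayley (S : Set Γ)) v p ≤
      theta (X □ mulCayley (S : Set Γ)) v (criticalProbIOf (X □ mulCayley (S : Set Γ)) v) :=
    theta_mono_holds _ _ (Subtype.coe_le_coe.mp hp)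
  have hnn : 0 ≤ theta (X □ mulCayley (S : Set Γ)) v p := MeasureTheory.measureReal_nonneg
  linarith

include C in
/-- **`θ_v(p_c) = 0` on `X □ Cay(Γ;S)`** for vertex-transitive `X` and a `CayleyFrm₂` on `(Γ, S)`, modulo N2 (the `p = p_c` case).
[cite: BenjaminiSchramm1996, Conj. 4; §2] -/
theorem criticalContinuity_boxProd_of_frmNode₁ (hN : SamePDropOfSkeletonFrm₁) (hc : X.Connected) {ΔX : ℕ} (hΔ : ∀ u, X.degree u ≤ ΔX)
    (hT : ∀ u u' : W, ∃ γ : X ≃g X, γ u = u') (v : W × Γ) :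
    theta (X □ mulCayley (S : Set Γ)) v (criticalProbIOf (X □ mulCayley (S : Set Γ)) v) = 0 :=
  C.theta_boxProd_eq_zero_of_le_of_frmNode₁ X hN hc hΔ hT v le_rfl

end CayleyFrm₂

/-! ## §4 Cayley factors: `Cay(Γ';S') □ Cay(Γ;S)` for EVERY finitely generated `Γ'`, no symmetry on `(Γ, S)` -/

namespace CayleyFrm₂

variable {Γ : Type} [Group Γ] {S : Finset Γ} (C : CayleyFrm₂ Γ S)
variable {Γ' : Type} [Group Γ'] (S' : Finset Γ')

include C in
/-- **`θ_v(p) = 0` for `p ≤ p_c` on `Cay(Γ';S') □ Cay(Γ;S)` for EVERY group `Γ'` with a finite generating set `S'`** (connected Cayley factor) and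
every `CayleyFrm₂` on `(Γ, S)`, modulo N2 — e.g. `Γ'` of intermediate growth, `(Γ, S)` a class-3 letters datum without symmetry.
[cite: BenjaminiSchramm1996, Conj. 4; §2] -/
theorem theta_cayleyProd_eq_zero_of_le_of_frmNode₁ [Countable Γ'] (hN : SamePDropOfSkeletonFrm₁) (hc : (mulCayley (S' : Set Γ')).Connected)
    (v : Γ' × Γ) {p : unitInterval} (hp : (p : ℝ) ≤ criticalProb (mulCayley (S' : Set Γ') □ mulCayley (S : Set Γ)) v) :
    theta (mulCayley (S' : Set Γ') □ mulCayley (S : Set Γ)) v p = 0 :=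
  C.theta_boxProd_eq_zero_of_le_of_frmNode₁ (mulCayley (S' : Set Γ')) hN hc (fun u => degree_mulCayley_le S' u)
    (fun u u' => ⟨leftMulIso S' (u' * u⁻¹), by rw [leftMulIso_apply, inv_mul_cancel_right]⟩) v hp

end CayleyFrm₂

end Summit.CriticalPhenomena.PercolationContinuityZ3.Theorems.Transplant

end
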